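import Literature.NumberTheory.EllipticCurves.NewformPeriodsGaloisEquivarianceRank
import HarnessLib

/-!
# Proof of Shimura's `σ`-equivariance of the plus periods of conjugate newforms
# (`shimura1977_plusSymbol_galoisEquivariant_holds`, weight 2, `Γ₀(N)`)

Topic `NumberTheory/EllipticCurves`; PROVES, from the tree, the statement of the named fact `shimura1977_plusSymbol_galoisEquivariant`
(`NewformPeriodsGaloisEquivariance.lean`, [Shimura1977] Thm. 1, plus part, modular-symbol form) as the theorem `plusSymbol_galoisEquivariant_of_conj`
(the one-line discharge `_holds` is filed separately once the fact file is in the tree):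

1. (`NewformPeriodsGaloisEquivarianceRank`) in the integral basis `b = (φ₁,…,φₙ)` of the period homology `H₁(X₀(N), ℤ) ⊆ S₂(Γ₀(N))^∨`
   (`periodHomology_eq_span_basis_holds`), Hecke-stable (`dualMap_heckeT_mem_periodHomology`), the kernel of `x ↦ ∑ xₖ φₖ(f)` on
   `K_fⁿ` is EXACTLY the Hecke span `U_f = ∑ K_f·([T_p^∨ φⱼ]_b − a_p(f) e_j)` (`PeriodRank.mem_heckeSpan_of_sum_eq_zero`; multiplicity one
   `mem_span_of_equiv_of_mem_newSubspace0`, values spanning `ℂ` by `periodLattice_span_eq_top`);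
2. the `σ`-twisted evaluation `x ↦ ∑ σ(xₖ) φₖ(f')` at the conjugate newform `f'` (`a_p(f') = σ(a_p(f))`) kills `U_f`
   (`PeriodRank.sum_twist_eq_zero_of_mem_heckeSpan`), so EVERY `K_f`-LINEAR RELATION AMONG THE PERIODS OF `f` ON RATIONAL CYCLES HOLDS,
   AFTER `σ`, FOR `f'`;
3. the Manin–Drinfeld cycles `n_r({∞,r} + {∞,−r}) ∈ H₁(X₀(N), ℤ)` are uniform in the form (`exists_nsmul_modularSymbol_eq_cuspSymbol`) and
   take the real values `2n_r·plusSymbol` at `f` and `f'`; real values of `K_f`-rational cycles at `f` lie on ONE `K_f`-line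
   (`IsNewform0.exists_re_im_mem_span_periodLattice`), so `[{∞,r}⁺] = q(r)·[{∞,r₀}⁺] (mod U_f)` with `q(r) ∈ K_f`, and step 2 transports
   this to `f'` with `σ(q(r))`.
No new named fact. References: [Shimura1977] Thm. 1; [Shimura1971] Thm. 7.14, §8.2; [Manin1972] Cor. 3.6; [CremonaAlgorithms1997] §2.8–2.10.
-/

noncomputable section

open scoped MatrixGroups ModularForm

open Module Submodule CongruenceSubgroup

namespace Literature.NumberTheory.EllipticCurves.ModularForms

namespace PeriodRank

variable {N : ℕ} [NeZero N]

/-- **A nonzero cusp form with real coefficients has a non-zero plus symbol**: otherwise every period `{∞, γ∞}_f` (a modular symbol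
`{∞, a/c}_f` or `0`) would be purely imaginary, while the periods span `ℂ` over `ℝ` (`periodLattice_span_eq_top`; Cremona: `Ω⁺(f) > 0`).
[cite: CremonaAlgorithms1997, §2.8] -/
theorem exists_plusSymbol_ne_zero {f : CuspForm (Gamma0 N) 2} (hf0 : f ≠ 0) (hreal : ∀ m, (cuspCoeff f m).im = 0) :
    ∃ r : ℚ, plusSymbol f r ≠ 0 := by
  by_contra hall
  push Not at hall
  have hre : ∀ r : ℚ, (modularSymbol f r).re = 0 := fun r ↦ by
    have h := hall r
    rw [plusSymbol_eq_re_holds f hreal r] at h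
    exact_mod_cast h
  have hker : span ℝ (periodLattice f : Set ℂ) ≤ LinearMap.ker Complex.reLm := by
    rw [span_le]
    intro z hz
    rw [SetLike.mem_coe, LinearMap.mem_ker, Complex.reLm_coe]
    induction hz using AddSubgroup.closure_induction with
    | mem x hx =>
      obtain ⟨γ, rfl⟩ := hx
      unfold cuspSymbol
      split_ifs
      · simp
      · exact hre _
    | zero => simp
    | add x y _ _ hx hy => rw [Complex.add_re, hx, hy, add_zero]
    | neg x _ hx => rw [Complex.neg_re, hx, neg_zero]
  rw [periodLattice_span_eq_top f hf0] at hker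
  have h1 : (1 : ℂ) ∈ LinearMap.ker Complex.reLm := hker trivial
  simp at h1

/-- **Manin–Drinfeld cycles for the plus symbols, in an integral basis of the period homology**: for every `r ∈ ℚ` there are an integer
`m > 0` and an INTEGER vector `x ∈ ℤⁿ` with `∑ₖ xₖ φₖ(g) = m · plusSymbol g r` for EVERY cusp form `g` (the cycle
`n_r n_{−r}({∞,r} + {∞,−r})`, `exists_nsmul_modularSymbol_eq_cuspSymbol`). [cite: Manin1972, Cor. 3.6] -/
theorem exists_int_coords_plusSymbol {n : ℕ} {b : Module.Basis (Fin n) ℝ (Module.Dual ℂ (CuspForm (Gamma0 N) 2))}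
    (hb : (periodHomology N : Set (Module.Dual ℂ (CuspForm (Gamma0 N) 2))) = span ℤ (Set.range b)) (r : ℚ) :
    ∃ (m : ℕ) (x : Fin n → ℤ), 0 < m ∧ ∀ g : CuspForm (Gamma0 N) 2, ∑ k, ((x k : ℤ) : ℂ) * b k g = (m : ℂ) * plusSymbol g r := by
  have coords : ∀ γ : Gamma0 N, ∃ c : Fin n → ℤ, ∀ g : CuspForm (Gamma0 N) 2, ∑ k, ((c k : ℤ) : ℂ) * b k g = cuspSymbol g γ := by
    intro γ
    have hmem : periodFunctional N γ ∈ (periodHomology N : Set _) := periodFunctional_mem_periodHomology N γ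
    rw [hb, SetLike.mem_coe, Submodule.mem_span_range_iff_exists_fun] at hmem
    obtain ⟨c, hc⟩ := hmem
    refine ⟨c, fun g ↦ ?_⟩
    have h := congrArg (fun φ : Module.Dual ℂ (CuspForm (Gamma0 N) 2) ↦ φ g) hc
    simp only [LinearMap.coe_sum, Finset.sum_apply, periodFunctional_apply] at h
    rw [← h]
    exact Finset.sum_congr rfl fun k _ ↦ by rw [← Int.cast_smul_eq_zsmul ℝ, LinearMap.smul_apply, Complex.real_smul, Complex.ofReal_intCast]
  obtain ⟨n₁, hn₁, γ₁, h₁⟩ := exists_nsmul_modularSymbol_eq_cuspSymbol N r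
  obtain ⟨n₂, hn₂, γ₂, h₂⟩ := exists_nsmul_modularSymbol_eq_cuspSymbol N (-r)
  obtain ⟨c₁, hc₁⟩ := coords γ₁
  obtain ⟨c₂, hc₂⟩ := coords γ₂
  refine ⟨2 * (n₁ * n₂), fun k ↦ (n₂ : ℤ) * c₁ k + (n₁ : ℤ) * c₂ k, by positivity, fun g ↦ ?_⟩
  have e₁ := hc₁ g
  have e₂ := hc₂ g
  rw [← h₁ g] at e₁
  rw [← h₂ g] at e₂
  simp only [nsmul_eq_mul] at e₁ e₂
  simp only [Int.cast_add, Int.cast_mul, Int.cast_natCast, add_mul, Finset.sum_add_distrib, mul_assoc, ← Finset.mul_sum, e₁, e₂, plusSymbol]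
  push_cast
  ring

/-- ★★★ **Shimura 1977, Theorem 1 (plus part, weight 2, `Γ₀(N)`), PROVED**: for conjugate normalised newforms `f, f' = f^σ ∈ S₂(Γ₀(N))`
(`a_n(f') = σ(a_n(f))` for a field embedding `σ : K_f → ℂ`) there are real `Ω ≠ 0`, `Ω' ≠ 0` and `q : ℚ → K_f` with `{∞,r}⁺_f = q(r)·Ω` and
`{∞,r}⁺_{f'} = σ(q(r))·Ω'` for every `r ∈ ℚ` — VERBATIM the statement of the named fact `shimura1977_plusSymbol_galoisEquivariant` (see the module
docstring for the proof). [cite: Shimura1977, Thm. 1] -/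
theorem plusSymbol_galoisEquivariant_of_conj (f f' : CuspForm (Gamma0 N) 2) (hf : IsNewform0 f) (hf' : IsNewform0 f')
    (σ : coeffField f →+* ℂ) (hconj : ∀ m : ℕ, cuspCoeff f' m = σ ⟨cuspCoeff f m, coeff_mem_coeffField f m⟩) :
    ∃ Ω Ω' : ℝ, Ω ≠ 0 ∧ Ω' ≠ 0 ∧ ∃ q : ℚ → coeffField f,
      ∀ r : ℚ, plusSymbol f r = (q r : ℂ) * Ω ∧ plusSymbol f' r = σ (q r) * Ω' := by
  classical
  have hK : ∀ x : coeffField f, (x : ℂ).im = 0 := fun x ↦ hf.im_eq_zero_of_mem_coeffField x.2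
  have hreal : ∀ m, (cuspCoeff f m).im = 0 := hf.cuspCoeff_im_eq_zero
  have hreal' : ∀ m, (cuspCoeff f' m).im = 0 := hf'.cuspCoeff_im_eq_zero
  have hf0 : f ≠ 0 := IsNormalized.ne_zero_gamma0 hf.2.2
  have hf0' : f' ≠ 0 := IsNormalized.ne_zero_gamma0 hf'.2.2
  have hcastZ : ∀ z : ℤ, (((z : coeffField f)) : ℂ) = (z : ℂ) := fun z ↦ map_intCast (algebraMap (coeffField f) ℂ) z
  obtain ⟨n, b, hb⟩ := periodHomology_eq_span_basis_holds N
  -- Hecke data in the integral basis `b`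
  let P := {p : ℕ // p.Prime ∧ ¬ p ∣ N}
  let T : P → CuspForm (Gamma0 N) 2 →ₗ[ℂ] CuspForm (Gamma0 N) 2 := fun p ↦
    haveI : NeZero (p : ℕ) := ⟨p.2.1.ne_zero⟩; heckeT (Gamma0 N) 2 p
  have hint : ∀ (i : P) (j : Fin n), ∃ c : Fin n → ℤ, (T i).dualMap (b j) = ∑ k, ((c k : ℤ) : ℝ) • b k := by
    intro i j
    have hbj : b j ∈ periodHomology N := by
      rw [← SetLike.mem_coe, hb]; exact Submodule.subset_span ⟨j, rfl⟩
    have hmem : (T i).dualMap (b j) ∈ (periodHomology N : Set _) := by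
      haveI : NeZero (i : ℕ) := ⟨i.2.1.ne_zero⟩
      exact dualMap_heckeT_mem_periodHomology N i.2.1 hbj
    rw [hb, SetLike.mem_coe, Submodule.mem_span_range_iff_exists_fun] at hmem
    obtain ⟨c, hc⟩ := hmem
    exact ⟨c, by rw [← hc]; exact Finset.sum_congr rfl fun k _ ↦ by rw [Int.cast_smul_eq_zsmul]⟩
  choose t ht using hint
  let a : P → coeffField f := fun p ↦ ⟨cuspCoeff f p, coeff_mem_coeffField f p⟩
  have hTf : ∀ i, T i f = ((a i : coeffField f) : ℂ) • f := fun i ↦ by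
    haveI : NeZero (i : ℕ) := ⟨i.2.1.ne_zero⟩
    exact hf.heckeT_eq_coeff_smul i.2.1
  have hTf' : ∀ i, T i f' = σ (a i) • f' := fun i ↦ by
    haveI : NeZero (i : ℕ) := ⟨i.2.1.ne_zero⟩
    have h : T i f' = (cuspCoeff f' (i : ℕ)) • f' := hf'.heckeT_eq_coeff_smul (f := f') i.2.1
    rw [hconj] at h
    exact h
  have hM1 : ∀ h : CuspForm (Gamma0 N) 2, (∀ i, T i h = ((a i : coeffField f) : ℂ) • h) →
      h ∈ span ℂ ({f} : Set (CuspForm (Gamma0 N) 2)) := by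
    intro h hh
    refine mem_span_of_equiv_of_mem_newSubspace0 (a := fun p ↦ cuspCoeff f p) hf0 hf.1 (fun p hp _ ↦ ?_) h (fun p hp hpN ↦ ?_)
    · haveI : NeZero p := ⟨hp.ne_zero⟩
      exact hf.heckeT_eq_coeff_smul hp
    · exact hh ⟨p, hp, hpN⟩
  -- the values `φₖ(f)` span `ℂ` over `ℝ`
  have hspan : span ℝ (Set.range fun k ↦ b k f) = ⊤ := by
    rw [eq_top_iff, ← periodLattice_span_eq_top f hf0, span_le]
    intro z hz
    rw [periodLattice_eq_map_periodHomology] at hz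
    obtain ⟨φ, hφ, rfl⟩ := AddSubgroup.mem_map.mp hz
    have hφ' : φ ∈ (periodHomology N : Set _) := hφ
    rw [hb, SetLike.mem_coe, Submodule.mem_span_range_iff_exists_fun] at hφ'
    obtain ⟨c, rfl⟩ := hφ'
    change (∑ k, c k • b k) f ∈ _
    rw [LinearMap.coe_sum, Finset.sum_apply]
    refine Submodule.sum_mem _ fun k _ ↦ ?_
    rw [← Int.cast_smul_eq_zsmul ℝ, LinearMap.smul_apply]
    exact Submodule.smul_mem _ _ (subset_span ⟨k, rfl⟩)
  -- the two evaluations in coordinates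
  let ev : (Fin n → coeffField f) →ₗ[coeffField f] ℂ :=
    { toFun := fun y ↦ ∑ k, ((y k : coeffField f) : ℂ) * b k f
      map_add' := fun y z ↦ by simp [Finset.sum_add_distrib, add_mul]
      map_smul' := fun c y ↦ by
        simp only [Pi.smul_apply, IntermediateField.smul_def, smul_eq_mul, RingHom.id_apply, Finset.mul_sum]
        exact Finset.sum_congr rfl fun k _ ↦ by push_cast; ring }
  have hevdef : ∀ y, ev y = ∑ k, ((y k : coeffField f) : ℂ) * b k f := fun _ ↦ rfl
  let evσ : (Fin n → coeffField f) →+ ℂ :=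
    { toFun := fun y ↦ ∑ k, σ (y k) * b k f'
      map_zero' := by simp
      map_add' := fun y z ↦ by simp [Finset.sum_add_distrib, add_mul] }
  have hevσdef : ∀ y, evσ y = ∑ k, σ (y k) * b k f' := fun _ ↦ rfl
  have hevσ_smul : ∀ (c : coeffField f) y, evσ (c • y) = σ c * evσ y := fun c y ↦ by
    simp [hevσdef, Finset.mul_sum, mul_assoc]
  -- EXACTNESS at `f`, and the twisted evaluation at `f'` kills the Hecke span
  have hexact : ∀ y : Fin n → coeffField f, ev y = 0 → evσ y = 0 := fun y hy ↦
    sum_twist_eq_zero_of_mem_heckeSpan ht σ hTf' (mem_heckeSpan_of_sum_eq_zero hK ht hf0 hTf hM1 hspan hy)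
  -- Manin–Drinfeld cycles
  choose m x hm hx using exists_int_coords_plusSymbol (N := N) hb
  let xK : ℚ → Fin n → coeffField f := fun r k ↦ ((x r k : ℤ) : coeffField f)
  have hev : ∀ r, ev (xK r) = (m r : ℂ) * plusSymbol f r := fun r ↦ by
    rw [← hx r f, hevdef]
    exact Finset.sum_congr rfl fun k _ ↦ by rw [hcastZ]
  have hev' : ∀ r, evσ (xK r) = (m r : ℂ) * plusSymbol f' r := fun r ↦ by
    rw [← hx r f', hevσdef]
    exact Finset.sum_congr rfl fun k _ ↦ by rw [map_intCast]
  -- the real values of `K`-rational cycles at `f` lie on one `K`-line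
  obtain ⟨Ωp, Ωm, hΩp, -, hline⟩ := hf.exists_re_im_mem_span_periodLattice
  have hmemΛ : ∀ r, ev (xK r) ∈ span (coeffField f) (periodLattice f : Set ℂ) := by
    intro r
    rw [hevdef]
    refine Submodule.sum_mem _ fun k _ ↦ ?_
    have hbk : b k f ∈ periodLattice f := by
      rw [periodLattice_eq_map_periodHomology]
      refine AddSubgroup.mem_map.mpr ⟨b k, ?_, rfl⟩
      rw [← SetLike.mem_coe, hb]; exact Submodule.subset_span ⟨k, rfl⟩
    have : ((xK r k : coeffField f) : ℂ) * b k f = (xK r k) • b k f := by rw [IntermediateField.smul_def, smul_eq_mul]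
    rw [this]
    exact Submodule.smul_mem _ _ (subset_span hbk)
  have hq : ∀ r, ∃ q : coeffField f, ev (xK r) = (q : ℂ) * Ωp := by
    intro r
    obtain ⟨⟨q, hqK, hq⟩, -⟩ := hline _ (hmemΛ r)
    refine ⟨⟨q, hqK⟩, ?_⟩
    change _ = q * Ωp
    rw [← hq, hev, plusSymbol_eq_re_holds f hreal r]
    norm_cast
  choose q hq using hq
  -- a base point `r₀` with non-zero plus symbol
  obtain ⟨r₀, hr₀⟩ := exists_plusSymbol_ne_zero hf0 hreal
  have hq₀ : q r₀ ≠ 0 := by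
    intro h0
    have := hq r₀
    rw [h0, hev] at this
    simp only [ZeroMemClass.coe_zero, zero_mul, mul_eq_zero, Nat.cast_eq_zero] at this
    rcases this with h | h
    · exact (hm r₀).ne' h
    · exact hr₀ h
  have hq₀' : ((q r₀ : coeffField f) : ℂ) ≠ 0 := fun h ↦ hq₀ (by exact_mod_cast h)
  -- transport of the relation `[x_r] = (q r / q r₀)·[x_{r₀}]` from `f` to `f'`
  have hrel : ∀ r, ev (xK r - (q r / q r₀) • xK r₀) = 0 := fun r ↦ by
    rw [map_sub, map_smul, IntermediateField.smul_def, smul_eq_mul, hq r, hq r₀]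
    push_cast
    field_simp
    ring
  have hrelf : ∀ r, (m r : ℂ) * plusSymbol f r = ((q r : ℂ) / (q r₀ : ℂ)) * ((m r₀ : ℂ) * plusSymbol f r₀) := fun r ↦ by
    have h := hrel r
    rw [map_sub, map_smul, sub_eq_zero, IntermediateField.smul_def, smul_eq_mul, hev, hev] at h
    rw [h]
    push_cast
    ring
  have hrel' : ∀ r, (m r : ℂ) * plusSymbol f' r = σ (q r / q r₀) * ((m r₀ : ℂ) * plusSymbol f' r₀) := fun r ↦ by
    have h := hexact _ (hrel r)
    rw [map_sub, hevσ_smul, hev', hev', sub_eq_zero] at h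
    exact h
  -- the periods
  have hΩ'0 : plusSymbol f' r₀ ≠ 0 := by
    intro h0
    obtain ⟨r₁, hr₁⟩ := exists_plusSymbol_ne_zero hf0' hreal'
    have h := hrel' r₁
    rw [h0, mul_zero, mul_zero, mul_eq_zero] at h
    rcases h with h | h
    · exact (hm r₁).ne' (by exact_mod_cast h)
    · exact hr₁ h
  have hP0 : (((plusSymbol f r₀).re : ℝ) : ℂ) = plusSymbol f r₀ := by rw [plusSymbol_eq_re_holds f hreal r₀]; simp
  have hP0' : (((plusSymbol f' r₀).re : ℝ) : ℂ) = plusSymbol f' r₀ := by rw [plusSymbol_eq_re_holds f' hreal' r₀]; simp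
  refine ⟨(plusSymbol f r₀).re, (plusSymbol f' r₀).re, ?_, ?_, fun r ↦ (q r / q r₀) * (((m r₀ : ℚ) / (m r : ℚ) : ℚ) : coeffField f),
    fun r ↦ ⟨?_, ?_⟩⟩
  · intro h; apply hr₀; rw [← hP0, h, Complex.ofReal_zero]
  · intro h; apply hΩ'0; rw [← hP0', h, Complex.ofReal_zero]
  · have hmr : (m r : ℂ) ≠ 0 := by exact_mod_cast (hm r).ne'
    have h := hrelf r
    rw [hP0]
    push_cast
    field_simp at h ⊢
    linear_combination h
  · have hmr : (m r : ℂ) ≠ 0 := by exact_mod_cast (hm r).ne'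
    have h := hrel' r
    rw [hP0', map_mul, map_ratCast]
    push_cast
    field_simp at h ⊢
    linear_combination h

end PeriodRank

end Literature.NumberTheory.EllipticCurves.ModularForms

end
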